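import Literature.NumberTheory.Automorphic.UnitaryGroupCotangentSpectralProjectionConj
import HarnessLib

/-!
# Crux `H413`, line `F0_P2aCohIsotypicLine` — S2⁻ FROM S2⁺: archimedean orthogonality for ANTIholomorphic cotangent pairs by
# complex conjugation on `L²` (B4-archimedean desk, seat F0P2a-p06 (g0); served item `stmt-HodgeConjecture-24833`)

HC_CM is proved only modulo the printed citations until rung 0 closes.

The registered line `Cruxes/H413/Lines/F0_P2aCohIsotypicLine.lean` (sha16 fe64be0a9875628f) has two archimedean-orthogonality stubs:
S2⁺ `stub_archOrth_hol : ArchOrthHolType` (a PAIR of holomorphic cotangent forms `Φ, Φ₃` of the CM factor whose coordinate `L²`-classes are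
trace-orthogonal has ALL archimedean translates of the classes of `Φ` orthogonal to the classes of `Φ₃`) and its mirror S2⁻
`stub_archOrth_antihol : ArchOrthAntiholType` for a pair of ANTIholomorphic cotangent forms (members of `holCotForms.map conjFun`).

This file proves **S2⁻ ⇐ S2⁺** (and the converse), so that S2⁻ closes the moment S2⁺ does:
`archOrth_antihol_of_hol : ⟨ArchOrthHolType body⟩ → ⟨ArchOrthAntiholType body⟩` with both bodies pasted TOKEN FOR TOKEN from the line
(ll. 134–146 and 151–163), whence the line's edition reads `theorem stub_archOrth_antihol : ArchOrthAntiholType :=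
F0P2aArchOrthAntihol.archOrth_antihol_of_hol stub_archOrth_hol` (defeq by delta).

## The mechanism
Complex conjugation `f ↦ f̄` is an anti-unitary operator of `L²(U(H)(L⁺) A \ U(H)(𝔸_{L⁺}), μ)` commuting with the regular representation
([BorelJacquet1979, §4.6]; tree: ★ `AdelicGroupData.conjL2`, ★ `rightRegular_conjL2`, ★ `L2.inner_star_star : ⟪f̄, ḡ⟫ = ⟪g, f⟫`), and the class
of a coordinate of the componentwise conjugate form `Φ̄ = conjFun Φ` is the conjugate class (★ `toQuotFun_conjFun`, ★ `conjL2_toLp`;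
[BorelWallach2000, VII 2.10]: conjugation exchanges the `(1,0)` and `(0,1)` cotangent forms).  So for `Φ = Ψ̄`, `Φ₃ = Ψ̄₃` with `Ψ, Ψ₃`
holomorphic: `∑ⱼ ⟪[Φ]ⱼ, [Φ₃]ⱼ⟫ = ∑ⱼ ⟪[Ψ₃]ⱼ, [Ψ]ⱼ⟫ = conj ∑ⱼ ⟪[Ψ]ⱼ, [Ψ₃]ⱼ⟫`, and
`⟪R(u)[Φ]ⱼ, [Φ₃]ⱼ'⟫ = ⟪\overline{R(u)[Ψ]ⱼ}, \overline{[Ψ₃]ⱼ'}⟫ = conj ⟪R(u)[Ψ]ⱼ, [Ψ₃]ⱼ'⟫`; S2⁺ for `(Ψ, Ψ₃)` gives S2⁻ for `(Φ, Φ₃)`.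

No new definition, no named fact, no `sorry`; imports ★ `UnitaryGroupCotangentSpectralProjectionConj` (which carries ★ `AutomorphicConjugate`
and the cotangent-form carriers ★ `UnitaryGroupCohomologicalForms`).

## References
* [BorelJacquet1979] A. Borel, H. Jacquet, *Automorphic forms and automorphic representations*, PSPM 33.1 (1979), §4.6.
* [BorelWallach2000] A. Borel, N. Wallach, *Continuous cohomology, discrete subgroups, and representations of reductive groups*, 2nd ed.
  (2000), VII 2.10, 3.2.
* [HarishChandraTAMS1953] Harish-Chandra, Trans. AMS 75 (1953), Cor. to Thm 2 (the content of S2⁺ itself; not used here).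
-/

-- the mandated namespace repeats `HodgeConjecture.HodgeConjecture`, as in every `Theorems/*.lean` of this sub-problem
set_option linter.dupNamespace false

noncomputable section

open MeasureTheory NumberField
open scoped InnerProductSpace ENNReal ComplexOrder Matrix

namespace Summit.HodgeConjecture.HodgeConjecture.Cruxes.H413.F0P2aArchOrthAntihol

open Literature.NumberTheory.Automorphic Literature.NumberTheory.Automorphic.UnitaryGroup
open Literature.NumberTheory.Automorphic.UnitaryGroup.CotangentForms (toQuotFun cmArchSection cmCompactFactor conjFun holCotForms
  toQuotFun_conjFun)

/-! ## §1 Two `L²` identities over any adelic group datum -/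

section L2

universe u

variable {K : Type} [Field K] [NumberField K] (𝒢 : AdelicGroupData.{u} K) (μ : Measure 𝒢.automorphicQuotient)

/-- `⟪f̄, ḡ⟫ = conj ⟪f, g⟫` in `L²` of the automorphic quotient (★ `L2.inner_star_star` and `inner_conj_symm`): complex conjugation is
anti-unitary. [cite: BorelJacquet1979, §4.6] -/
theorem inner_star_star_eq_conj (f g : 𝒢.L2 μ) : ⟪(star f : 𝒢.L2 μ), star g⟫_ℂ = (starRingEnd ℂ) ⟪f, g⟫_ℂ := by
  rw [AdelicGroupData.L2.inner_star_star, inner_conj_symm]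

variable [SMulInvariantMeasure 𝒢.Adelic 𝒢.automorphicQuotient μ]

/-- `⟪R(x) f̄, ḡ⟫ = conj ⟪R(x) f, g⟫`: conjugation commutes with the regular representation (★ `rightRegular_conjL2`) and is anti-unitary.
[cite: BorelJacquet1979, §4.6] -/
theorem inner_rightRegular_star_star (x : 𝒢.Adelic) (f g : 𝒢.L2 μ) :
    ⟪𝒢.rightRegular μ x (star f), (star g : 𝒢.L2 μ)⟫_ℂ = (starRingEnd ℂ) ⟪𝒢.rightRegular μ x f, g⟫_ℂ := by
  rw [← AdelicGroupData.conjL2_apply, AdelicGroupData.rightRegular_conjL2, AdelicGroupData.conjL2_apply,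
    inner_star_star_eq_conj]

end L2

/-! ## §2 Coordinate classes of conjugate forms over any unitary datum `(F, E, c, N, J)` -/

section Classes

variable {F E : Type} [Field F] [NumberField F] [Field E] [NumberField E] [Algebra F E]
  {c : E ≃ₐ[F] E} {N : ℕ} {J : Matrix (Fin N) (Fin N) E}
  {μ : Measure (adelicGroupData F E c N J).automorphicQuotient}

/-- The coordinates of `Φ̄` are square-integrable on the quotient iff those of `Φ` are (forward direction; `MemLp.star`).
[cite: BorelWallach2000, VII 2.10] -/
theorem memLp_toQuotFun_of_conjFun {Φ : (adelicGroupData F E c N J).Adelic → (Fin 2 → ℂ)} {j : Fin 2}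
    (h : MemLp (toQuotFun (adelicGroupData F E c N J) fun g => conjFun F E c N J Φ g j) 2 μ) :
    MemLp (toQuotFun (adelicGroupData F E c N J) fun g => Φ g j) 2 μ := by
  have h' := h.star
  rw [toQuotFun_conjFun, star_star] at h'
  exact h'

/-- **The class of a coordinate of `Φ̄` is the conjugate of the class of that coordinate of `Φ`** (★ `conjL2_toLp`; the `MemLp` witnesses are
irrelevant). [cite: BorelWallach2000, VII 2.10] [cite: BorelJacquet1979, §4.6] -/
theorem toLp_toQuotFun_conjFun {Φ : (adelicGroupData F E c N J).Adelic → (Fin 2 → ℂ)} {j : Fin 2}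
    (h : MemLp (toQuotFun (adelicGroupData F E c N J) fun g => conjFun F E c N J Φ g j) 2 μ)
    (h' : MemLp (toQuotFun (adelicGroupData F E c N J) fun g => Φ g j) 2 μ) :
    h.toLp (toQuotFun (adelicGroupData F E c N J) fun g => conjFun F E c N J Φ g j) =
      star (h'.toLp (toQuotFun (adelicGroupData F E c N J) fun g => Φ g j)) := by
  rw [← AdelicGroupData.conjL2_apply, AdelicGroupData.conjL2_toLp]
  rfl

end Classes

/-! ## §3 S2⁻ ⇐ S2⁺ (types = the registered bodies `ArchOrthHolType` → `ArchOrthAntiholType`, token for token) -/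

/-- **S2⁻ from S2⁺.**  If, for the CM engine datum `(L, ι, H, T, hT)` (`H` definite away from `ι`, `[L⁺:ℚ] ≥ 2`), every automorphic measure
and every PAIR of HOLOMORPHIC cotangent forms `Φ, Φ₃` with square-integrable, trace-orthogonal coordinate classes, all archimedean translates
of the classes of `Φ` are orthogonal to the classes of `Φ₃` (hypothesis = the body of `F0P2aCohIsotypicLine.ArchOrthHolType`), then the same
holds for every pair of ANTIHOLOMORPHIC cotangent forms (conclusion = the body of `F0P2aCohIsotypicLine.ArchOrthAntiholType`): write `Φ = Ψ̄`,
`Φ₃ = Ψ̄₃`; complex conjugation on `L²` is anti-unitary, commutes with `R`, and carries `[Ψ]ⱼ` to `[Φ]ⱼ`.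
HC_CM is proved only modulo the printed citations until rung 0 closes. [cite: BorelWallach2000, VII 2.10] [cite: BorelJacquet1979, §4.6] -/
theorem archOrth_antihol_of_hol
    (hα : ∀ (L : Type) [Field L] [NumberField L] [IsCMField L] (ι : L →+* ℂ) (H : Matrix (Fin 3) (Fin 3) L) (T : GL (Fin 3) ℂ)
      (hT : (T : Matrix (Fin 3) (Fin 3) ℂ)ᴴ * H.map ι * (T : Matrix (Fin 3) (Fin 3) ℂ) = Literature.Geometry.ComplexHyperbolic.BallModel.J),
      (∀ τ' : L →+* ℂ, InfinitePlace.mk τ' ≠ InfinitePlace.mk ι → (H.map τ').PosDef) →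
      2 ≤ Module.finrank ℚ ↥(maximalRealSubfield L) →
      ∀ (μ : Measure (adelicGroupData (↥(maximalRealSubfield L)) L (IsCMField.complexConj L) 3 H).automorphicQuotient)
        [(adelicGroupData (↥(maximalRealSubfield L)) L (IsCMField.complexConj L) 3 H).IsAutomorphicMeasure μ]
        (Φ Φ₃ : (adelicGroupData (↥(maximalRealSubfield L)) L (IsCMField.complexConj L) 3 H).Adelic → (Fin 2 → ℂ)),
        Φ ∈ CotangentForms.holCotForms (↥(maximalRealSubfield L)) L (IsCMField.complexConj L) 3 H (cmArchSection L ι H T hT)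
          (cmCompactFactor L ι H T hT) →
        Φ₃ ∈ CotangentForms.holCotForms (↥(maximalRealSubfield L)) L (IsCMField.complexConj L) 3 H (cmArchSection L ι H T hT)
          (cmCompactFactor L ι H T hT) →
      ∀ (hΦ : ∀ j : Fin 2, MemLp (toQuotFun (adelicGroupData (↥(maximalRealSubfield L)) L (IsCMField.complexConj L) 3 H) fun x => Φ x j) 2 μ)
        (h₃ : ∀ j : Fin 2, MemLp (toQuotFun (adelicGroupData (↥(maximalRealSubfield L)) L (IsCMField.complexConj L) 3 H) fun x => Φ₃ x j) 2 μ),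
      ∑ j : Fin 2, ⟪(hΦ j).toLp (toQuotFun (adelicGroupData (↥(maximalRealSubfield L)) L (IsCMField.complexConj L) 3 H) fun x => Φ x j),
        (h₃ j).toLp (toQuotFun (adelicGroupData (↥(maximalRealSubfield L)) L (IsCMField.complexConj L) 3 H) fun x => Φ₃ x j)⟫_ℂ = 0 →
      ∀ (u : Literature.Geometry.ComplexHyperbolic.BallModel.U21) (j j' : Fin 2),
        ⟪(adelicGroupData (↥(maximalRealSubfield L)) L (IsCMField.complexConj L) 3 H).rightRegular μ (cmArchSection L ι H T hT u)
            ((hΦ j).toLp (toQuotFun (adelicGroupData (↥(maximalRealSubfield L)) L (IsCMField.complexConj L) 3 H) fun x => Φ x j)),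
          (h₃ j').toLp (toQuotFun (adelicGroupData (↥(maximalRealSubfield L)) L (IsCMField.complexConj L) 3 H) fun x => Φ₃ x j')⟫_ℂ = 0) :
    ∀ (L : Type) [Field L] [NumberField L] [IsCMField L] (ι : L →+* ℂ) (H : Matrix (Fin 3) (Fin 3) L) (T : GL (Fin 3) ℂ)
      (hT : (T : Matrix (Fin 3) (Fin 3) ℂ)ᴴ * H.map ι * (T : Matrix (Fin 3) (Fin 3) ℂ) = Literature.Geometry.ComplexHyperbolic.BallModel.J),
      (∀ τ' : L →+* ℂ, InfinitePlace.mk τ' ≠ InfinitePlace.mk ι → (H.map τ').PosDef) →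
      2 ≤ Module.finrank ℚ ↥(maximalRealSubfield L) →
      ∀ (μ : Measure (adelicGroupData (↥(maximalRealSubfield L)) L (IsCMField.complexConj L) 3 H).automorphicQuotient)
        [(adelicGroupData (↥(maximalRealSubfield L)) L (IsCMField.complexConj L) 3 H).IsAutomorphicMeasure μ]
        (Φ Φ₃ : (adelicGroupData (↥(maximalRealSubfield L)) L (IsCMField.complexConj L) 3 H).Adelic → (Fin 2 → ℂ)),
        Φ ∈ (CotangentForms.holCotForms (↥(maximalRealSubfield L)) L (IsCMField.complexConj L) 3 H (cmArchSection L ι H T hT)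
          (cmCompactFactor L ι H T hT)).map (CotangentForms.conjFun (↥(maximalRealSubfield L)) L (IsCMField.complexConj L) 3 H) →
        Φ₃ ∈ (CotangentForms.holCotForms (↥(maximalRealSubfield L)) L (IsCMField.complexConj L) 3 H (cmArchSection L ι H T hT)
          (cmCompactFactor L ι H T hT)).map (CotangentForms.conjFun (↥(maximalRealSubfield L)) L (IsCMField.complexConj L) 3 H) →
      ∀ (hΦ : ∀ j : Fin 2, MemLp (toQuotFun (adelicGroupData (↥(maximalRealSubfield L)) L (IsCMField.complexConj L) 3 H) fun x => Φ x j) 2 μ)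
        (h₃ : ∀ j : Fin 2, MemLp (toQuotFun (adelicGroupData (↥(maximalRealSubfield L)) L (IsCMField.complexConj L) 3 H) fun x => Φ₃ x j) 2 μ),
      ∑ j : Fin 2, ⟪(hΦ j).toLp (toQuotFun (adelicGroupData (↥(maximalRealSubfield L)) L (IsCMField.complexConj L) 3 H) fun x => Φ x j),
        (h₃ j).toLp (toQuotFun (adelicGroupData (↥(maximalRealSubfield L)) L (IsCMField.complexConj L) 3 H) fun x => Φ₃ x j)⟫_ℂ = 0 →
      ∀ (u : Literature.Geometry.ComplexHyperbolic.BallModel.U21) (j j' : Fin 2),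
        ⟪(adelicGroupData (↥(maximalRealSubfield L)) L (IsCMField.complexConj L) 3 H).rightRegular μ (cmArchSection L ι H T hT u)
            ((hΦ j).toLp (toQuotFun (adelicGroupData (↥(maximalRealSubfield L)) L (IsCMField.complexConj L) 3 H) fun x => Φ x j)),
          (h₃ j').toLp (toQuotFun (adelicGroupData (↥(maximalRealSubfield L)) L (IsCMField.complexConj L) 3 H) fun x => Φ₃ x j')⟫_ℂ = 0 := by
  intro L _ _ _ ι H T hT hdef h2 μ _ Φ Φ₃ hΦmem h₃mem hΦ h₃ horth u j j'
  obtain ⟨Ψ, hΨ, rfl⟩ := Submodule.mem_map.mp hΦmem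
  obtain ⟨Ψ₃, hΨ₃, rfl⟩ := Submodule.mem_map.mp h₃mem
  -- the holomorphic partners have square-integrable coordinates, and the classes of `Φ = Ψ̄`, `Φ₃ = Ψ̄₃` are the conjugate classes
  have hΨL : ∀ i : Fin 2,
      MemLp (toQuotFun (adelicGroupData (↥(maximalRealSubfield L)) L (IsCMField.complexConj L) 3 H) fun x => Ψ x i) 2 μ :=
    fun i => memLp_toQuotFun_of_conjFun (hΦ i)
  have hΨ₃L : ∀ i : Fin 2,
      MemLp (toQuotFun (adelicGroupData (↥(maximalRealSubfield L)) L (IsCMField.complexConj L) 3 H) fun x => Ψ₃ x i) 2 μ :=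
    fun i => memLp_toQuotFun_of_conjFun (h₃ i)
  have e : ∀ i : Fin 2, (hΦ i).toLp _ = star ((hΨL i).toLp _) := fun i => toLp_toQuotFun_conjFun (hΦ i) (hΨL i)
  have e₃ : ∀ i : Fin 2, (h₃ i).toLp _ = star ((hΨ₃L i).toLp _) := fun i => toLp_toQuotFun_conjFun (h₃ i) (hΨ₃L i)
  -- trace-orthogonality of the holomorphic partners: `∑ⱼ ⟪[Ψ]ⱼ, [Ψ₃]ⱼ⟫ = conj ∑ⱼ ⟪[Φ]ⱼ, [Φ₃]ⱼ⟫ = 0`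
  have horth' : ∑ i : Fin 2,
      ⟪(hΨL i).toLp (toQuotFun (adelicGroupData (↥(maximalRealSubfield L)) L (IsCMField.complexConj L) 3 H) fun x => Ψ x i),
        (hΨ₃L i).toLp (toQuotFun (adelicGroupData (↥(maximalRealSubfield L)) L (IsCMField.complexConj L) 3 H) fun x => Ψ₃ x i)⟫_ℂ = 0 := by
    have hconj : (starRingEnd ℂ) (∑ i : Fin 2,
        ⟪(hΨL i).toLp (toQuotFun (adelicGroupData (↥(maximalRealSubfield L)) L (IsCMField.complexConj L) 3 H) fun x => Ψ x i),
          (hΨ₃L i).toLp (toQuotFun (adelicGroupData (↥(maximalRealSubfield L)) L (IsCMField.complexConj L) 3 H) fun x => Ψ₃ x i)⟫_ℂ) = 0 := by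
      rw [map_sum, ← horth]
      exact Finset.sum_congr rfl fun i _ => by rw [e i, e₃ i, inner_star_star_eq_conj]
    have := congrArg (starRingEnd ℂ) hconj
    rwa [RCLike.conj_conj, map_zero] at this
  -- S2⁺ for `(Ψ, Ψ₃)`, then conjugate
  have hres := hα L ι H T hT hdef h2 μ Ψ Ψ₃ hΨ hΨ₃ hΨL hΨ₃L horth' u j j'
  rw [e j, e₃ j', inner_rightRegular_star_star, hres, map_zero]

/-- **S2⁺ from S2⁻** (the converse, by the same conjugation: `\overline{Ψ̄} = Ψ`), so the two archimedean-orthogonality stubs of the line are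
ONE socket. HC_CM is proved only modulo the printed citations until rung 0 closes. [cite: BorelWallach2000, VII 2.10] [cite: BorelJacquet1979, §4.6] -/
theorem archOrth_hol_of_antihol
    (hα : ∀ (L : Type) [Field L] [NumberField L] [IsCMField L] (ι : L →+* ℂ) (H : Matrix (Fin 3) (Fin 3) L) (T : GL (Fin 3) ℂ)
      (hT : (T : Matrix (Fin 3) (Fin 3) ℂ)ᴴ * H.map ι * (T : Matrix (Fin 3) (Fin 3) ℂ) = Literature.Geometry.ComplexHyperbolic.BallModel.J),
      (∀ τ' : L →+* ℂ, InfinitePlace.mk τ' ≠ InfinitePlace.mk ι → (H.map τ').PosDef) →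
      2 ≤ Module.finrank ℚ ↥(maximalRealSubfield L) →
      ∀ (μ : Measure (adelicGroupData (↥(maximalRealSubfield L)) L (IsCMField.complexConj L) 3 H).automorphicQuotient)
        [(adelicGroupData (↥(maximalRealSubfield L)) L (IsCMField.complexConj L) 3 H).IsAutomorphicMeasure μ]
        (Φ Φ₃ : (adelicGroupData (↥(maximalRealSubfield L)) L (IsCMField.complexConj L) 3 H).Adelic → (Fin 2 → ℂ)),
        Φ ∈ (CotangentForms.holCotForms (↥(maximalRealSubfield L)) L (IsCMField.complexConj L) 3 H (cmArchSection L ι H T hT)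
          (cmCompactFactor L ι H T hT)).map (CotangentForms.conjFun (↥(maximalRealSubfield L)) L (IsCMField.complexConj L) 3 H) →
        Φ₃ ∈ (CotangentForms.holCotForms (↥(maximalRealSubfield L)) L (IsCMField.complexConj L) 3 H (cmArchSection L ι H T hT)
          (cmCompactFactor L ι H T hT)).map (CotangentForms.conjFun (↥(maximalRealSubfield L)) L (IsCMField.complexConj L) 3 H) →
      ∀ (hΦ : ∀ j : Fin 2, MemLp (toQuotFun (adelicGroupData (↥(maximalRealSubfield L)) L (IsCMField.complexConj L) 3 H) fun x => Φ x j) 2 μ)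
        (h₃ : ∀ j : Fin 2, MemLp (toQuotFun (adelicGroupData (↥(maximalRealSubfield L)) L (IsCMField.complexConj L) 3 H) fun x => Φ₃ x j) 2 μ),
      ∑ j : Fin 2, ⟪(hΦ j).toLp (toQuotFun (adelicGroupData (↥(maximalRealSubfield L)) L (IsCMField.complexConj L) 3 H) fun x => Φ x j),
        (h₃ j).toLp (toQuotFun (adelicGroupData (↥(maximalRealSubfield L)) L (IsCMField.complexConj L) 3 H) fun x => Φ₃ x j)⟫_ℂ = 0 →
      ∀ (u : Literature.Geometry.ComplexHyperbolic.BallModel.U21) (j j' : Fin 2),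
        ⟪(adelicGroupData (↥(maximalRealSubfield L)) L (IsCMField.complexConj L) 3 H).rightRegular μ (cmArchSection L ι H T hT u)
            ((hΦ j).toLp (toQuotFun (adelicGroupData (↥(maximalRealSubfield L)) L (IsCMField.complexConj L) 3 H) fun x => Φ x j)),
          (h₃ j').toLp (toQuotFun (adelicGroupData (↥(maximalRealSubfield L)) L (IsCMField.complexConj L) 3 H) fun x => Φ₃ x j')⟫_ℂ = 0) :
    ∀ (L : Type) [Field L] [NumberField L] [IsCMField L] (ι : L →+* ℂ) (H : Matrix (Fin 3) (Fin 3) L) (T : GL (Fin 3) ℂ)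
      (hT : (T : Matrix (Fin 3) (Fin 3) ℂ)ᴴ * H.map ι * (T : Matrix (Fin 3) (Fin 3) ℂ) = Literature.Geometry.ComplexHyperbolic.BallModel.J),
      (∀ τ' : L →+* ℂ, InfinitePlace.mk τ' ≠ InfinitePlace.mk ι → (H.map τ').PosDef) →
      2 ≤ Module.finrank ℚ ↥(maximalRealSubfield L) →
      ∀ (μ : Measure (adelicGroupData (↥(maximalRealSubfield L)) L (IsCMField.complexConj L) 3 H).automorphicQuotient)
        [(adelicGroupData (↥(maximalRealSubfield L)) L (IsCMField.complexConj L) 3 H).IsAutomorphicMeasure μ]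
        (Φ Φ₃ : (adelicGroupData (↥(maximalRealSubfield L)) L (IsCMField.complexConj L) 3 H).Adelic → (Fin 2 → ℂ)),
        Φ ∈ CotangentForms.holCotForms (↥(maximalRealSubfield L)) L (IsCMField.complexConj L) 3 H (cmArchSection L ι H T hT)
          (cmCompactFactor L ι H T hT) →
        Φ₃ ∈ CotangentForms.holCotForms (↥(maximalRealSubfield L)) L (IsCMField.complexConj L) 3 H (cmArchSection L ι H T hT)
          (cmCompactFactor L ι H T hT) →
      ∀ (hΦ : ∀ j : Fin 2, MemLp (toQuotFun (adelicGroupData (↥(maximalRealSubfield L)) L (IsCMField.complexConj L) 3 H) fun x => Φ x j) 2 μ)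
        (h₃ : ∀ j : Fin 2, MemLp (toQuotFun (adelicGroupData (↥(maximalRealSubfield L)) L (IsCMField.complexConj L) 3 H) fun x => Φ₃ x j) 2 μ),
      ∑ j : Fin 2, ⟪(hΦ j).toLp (toQuotFun (adelicGroupData (↥(maximalRealSubfield L)) L (IsCMField.complexConj L) 3 H) fun x => Φ x j),
        (h₃ j).toLp (toQuotFun (adelicGroupData (↥(maximalRealSubfield L)) L (IsCMField.complexConj L) 3 H) fun x => Φ₃ x j)⟫_ℂ = 0 →
      ∀ (u : Literature.Geometry.ComplexHyperbolic.BallModel.U21) (j j' : Fin 2),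
        ⟪(adelicGroupData (↥(maximalRealSubfield L)) L (IsCMField.complexConj L) 3 H).rightRegular μ (cmArchSection L ι H T hT u)
            ((hΦ j).toLp (toQuotFun (adelicGroupData (↥(maximalRealSubfield L)) L (IsCMField.complexConj L) 3 H) fun x => Φ x j)),
          (h₃ j').toLp (toQuotFun (adelicGroupData (↥(maximalRealSubfield L)) L (IsCMField.complexConj L) 3 H) fun x => Φ₃ x j')⟫_ℂ = 0 := by
  intro L _ _ _ ι H T hT hdef h2 μ _ Ψ Ψ₃ hΨ hΨ₃ hΨL hΨ₃L horth u j j'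
  -- the conjugates `Φ = Ψ̄`, `Φ₃ = Ψ̄₃` are antiholomorphic with square-integrable coordinates
  have hΦL : ∀ i : Fin 2, MemLp (toQuotFun (adelicGroupData (↥(maximalRealSubfield L)) L (IsCMField.complexConj L) 3 H) fun x =>
      conjFun (↥(maximalRealSubfield L)) L (IsCMField.complexConj L) 3 H Ψ x i) 2 μ := fun i => by
    rw [toQuotFun_conjFun]
    exact (hΨL i).star
  have h₃L : ∀ i : Fin 2, MemLp (toQuotFun (adelicGroupData (↥(maximalRealSubfield L)) L (IsCMField.complexConj L) 3 H) fun x =>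
      conjFun (↥(maximalRealSubfield L)) L (IsCMField.complexConj L) 3 H Ψ₃ x i) 2 μ := fun i => by
    rw [toQuotFun_conjFun]
    exact (hΨ₃L i).star
  have e : ∀ i : Fin 2, (hΦL i).toLp _ = star ((hΨL i).toLp _) := fun i => toLp_toQuotFun_conjFun (hΦL i) (hΨL i)
  have e₃ : ∀ i : Fin 2, (h₃L i).toLp _ = star ((hΨ₃L i).toLp _) := fun i => toLp_toQuotFun_conjFun (h₃L i) (hΨ₃L i)
  have horth' : ∑ i : Fin 2, ⟪(hΦL i).toLp (toQuotFun (adelicGroupData (↥(maximalRealSubfield L)) L (IsCMField.complexConj L) 3 H) fun x =>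
      conjFun (↥(maximalRealSubfield L)) L (IsCMField.complexConj L) 3 H Ψ x i), (h₃L i).toLp (toQuotFun
        (adelicGroupData (↥(maximalRealSubfield L)) L (IsCMField.complexConj L) 3 H) fun x =>
          conjFun (↥(maximalRealSubfield L)) L (IsCMField.complexConj L) 3 H Ψ₃ x i)⟫_ℂ = 0 := by
    rw [← map_zero (starRingEnd ℂ), ← horth, map_sum]
    exact Finset.sum_congr rfl fun i _ => by rw [e i, e₃ i, inner_star_star_eq_conj]
  have hres := hα L ι H T hT hdef h2 μ _ _ (Submodule.mem_map_of_mem hΨ) (Submodule.mem_map_of_mem hΨ₃) hΦL h₃L horth' u j j'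
  rw [e j, e₃ j', inner_rightRegular_star_star, map_eq_zero_iff _ (RingHom.injective _)] at hres
  exact hres

end Summit.HodgeConjecture.HodgeConjecture.Cruxes.H413.F0P2aArchOrthAntihol

end
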